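import Summits.QuantumFields.BalabanUV.Beta.EriceRemainderEnclosureHistoryAutonomyComparisonDefectSecondMomentEnclosure

/-!
# EriceRemainderEnclosureHistoryAutonomyComparisonDefectInfiniteMemoryLinks — (E140m) BRICKS FOR INFINITE MEMORY: truncations of a functional with an infinite (fading)
# history inherit the structure, and a constant shift moves the levels of a structured orbit by at most `j·d`.
The comparison column's structured memories have a level-Lipschitz age profile on `Finset.range K` — a FINITE memory.  (E140k)∕(E140l) made the enclosure constant
`c₂ = θ₂·2ε∕(1−θ)` FREE of `K`; the sequel (E140n) `…ComparisonDefectInfiniteMemory` removes `K` from the HYPOTHESES as well, by truncation and a limit: a functional `B`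
with INFINITE memory whose WINDOW profiles (level-Lipschitz bound in the first `K` coordinates when the rest agree) have bounded first and second age moments and whose
TAILS fade (`|B u − B v| ≤ η_K` when the first `K` coordinates agree, `η_K → 0`) is, for every `K`, `η_K`-close to its TRUNCATION `B_K u := B(u_0, …, u_{K−1}, c, c, …)` — a
finite-memory structured functional to which (E140l) applies.  This file: the truncation inherits isotonicity (`trunc_mono`), the zeroth moment (`trunc_zm`), floor and
ceiling (`trunc_floor`, `trunc_upper`), and the finite profile (`trunc_profile`); it is `η_K`-close (`trunc_close`); and the CONSTANT-SHIFT LEVEL GAP (`const_shift_levels`):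
for a structured finite-memory `B₁` and `d ≥ 0`, the orbits `h₁` of `B₁` and `h₂` of `B₁ + d` from one pin satisfy `h₂ ≤ h₁` and `1∕h₂_j² ≤ 1∕h₁_j² + j·d`.

Cell `pub-balaban`, β-function sub-cell, BINDER row D4 «RemainderConst leaves for Bałaban's split» (`HOME/BINDER-OWNERS.md`; owner lineage `b2b-balaban-beta-an4`;
this file by co-owner #2 lineage `b2b-balaban-beta-d4-p2`, generation 108), β-FLOW TEAM duty (1), FREEZE (0) honoured (def-free: the truncation is the displayed lambda
`fun u => B (fun i => if i < K then u i else c)`; (E140a) `le_of_excess_defect` BY NAME; nothing restated).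

HONEST FRAMING (page 1, verbatim and binding).  *"Discharging BetaPertH makes Bałaban's UV stability UNCONDITIONAL — a real constructive-QFT result; it is
NOT the continuum limit and NOT the Clay problem."*  THIS FILE DISCHARGES NOTHING OF THE KIND.  Elementary real analysis about ABSTRACT functionals on a box
]0,γ]^ℕ — hypotheses of a census, not facts: whether Bałaban's (1.22) limit functional has fading tails and window profiles with bounded age moments is NOT PRINTED ([I]
p. 298; GAPS G-t4-U2-1∕-2) and NOT asserted.  Row D4 class UNCHANGED (critical-path width 0; instance 0∕1; D4 DISCHARGE NO DATE).  NOT B12 Thm 2, NOT BetaPertH, NOT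
continuum YM, NOT Clay.

WHAT IS PROVED ([folklore]; 0 `def`, 0 sorry).  §1 `trunc_box`, `trunc_le_trunc`, `trunc_mono`, `trunc_zm`, `trunc_floor`, `trunc_upper`, `trunc_profile`, `trunc_close`.
§2 **`const_shift_levels`**.
-/

noncomputable section
open Finset Set

namespace Summit.QuantumFields.BalabanUV.Beta.EriceRemainderEnclosureHistoryAutonomyComparisonDefectInfiniteMemoryLinks

open Literature.MathematicalPhysics.QuantumFieldTheory.Balaban1983to89
open Literature.MathematicalPhysics.QuantumFieldTheory.Balaban1983to89.T4BetaStationary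
open Literature.MathematicalPhysics.QuantumFieldTheory.Balaban1983to89.T4BetaFlowWellPosed
open Summit.QuantumFields.BalabanUV.Beta.EriceRemainderEnclosureHistoryAutonomyComparisonDefect (le_of_excess_defect)

variable {B : (ℕ → ℝ) → ℝ} {M γ b c : ℝ} {K : ℕ}

/-! ## §1 The truncation `B_K u = B(u_0, …, u_{K−1}, c, c, …)` -/

/-- The truncated configuration stays in the box (`c ∈ ]0,γ]`). [folklore] -/
theorem trunc_box (hc : 0 < c) (hcγ : c ≤ γ) {u : ℕ → ℝ} (hu : SeqBox γ u) : SeqBox γ (fun i => if i < K then u i else c) := by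
  intro i
  by_cases hi : i < K
  · simp only [if_pos hi]; exact hu i
  · simp only [if_neg hi]; exact ⟨hc, hcγ⟩

/-- Truncation is monotone in the configuration. [folklore] -/
theorem trunc_le_trunc {u v : ℕ → ℝ} (huv : ∀ i, u i ≤ v i) (i : ℕ) :
    (fun i => if i < K then u i else c) i ≤ (fun i => if i < K then v i else c) i := by
  show (if i < K then u i else c) ≤ (if i < K then v i else c)
  by_cases hi : i < K
  · simp only [if_pos hi]; exact huv i
  · simp only [if_neg hi]; exact le_rfl

/-- **The truncation of an isotone functional is isotone.** [folklore] -/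
theorem trunc_mono (hc : 0 < c) (hcγ : c ≤ γ)
    (hmono : ∀ u v : ℕ → ℝ, SeqBox γ u → SeqBox γ v → (∀ i, u i ≤ v i) → B u ≤ B v) :
    ∀ u v : ℕ → ℝ, SeqBox γ u → SeqBox γ v → (∀ i, u i ≤ v i) →
      (fun w : ℕ → ℝ => B (fun i => if i < K then w i else c)) u ≤ (fun w : ℕ → ℝ => B (fun i => if i < K then w i else c)) v :=
  fun _ _ hu hv huv => hmono _ _ (trunc_box hc hcγ hu) (trunc_box hc hcγ hv) (trunc_le_trunc huv)

/-- **The truncation keeps the zeroth moment.** [folklore] -/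
theorem trunc_zm (hc : 0 < c) (hcγ : c ≤ γ)
    (hB : ∀ u u' : ℕ → ℝ, SeqBox γ u → SeqBox γ u' → ∀ D : ℝ, (∀ j, |u j - u' j| ≤ D) → |B u - B u'| ≤ M * D) :
    ∀ u u' : ℕ → ℝ, SeqBox γ u → SeqBox γ u' → ∀ D : ℝ, (∀ j, |u j - u' j| ≤ D) →
      |(fun w : ℕ → ℝ => B (fun i => if i < K then w i else c)) u - (fun w : ℕ → ℝ => B (fun i => if i < K then w i else c)) u'| ≤ M * D := by
  intro u u' hu hu' D hD
  have hD0 : 0 ≤ D := (abs_nonneg _).trans (hD 0)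
  refine hB _ _ (trunc_box hc hcγ hu) (trunc_box hc hcγ hu') D fun j => ?_
  show |(if j < K then u j else c) - (if j < K then u' j else c)| ≤ D
  by_cases hj : j < K
  · simp only [if_pos hj]; exact hD j
  · simp only [if_neg hj, sub_self, abs_zero]; exact hD0

/-- The truncation keeps the floor … [folklore] -/
theorem trunc_floor (hc : 0 < c) (hcγ : c ≤ γ) (hlo : ∀ u, SeqBox γ u → b ≤ B u) :
    ∀ u, SeqBox γ u → b ≤ (fun w : ℕ → ℝ => B (fun i => if i < K then w i else c)) u :=
  fun _ hu => hlo _ (trunc_box hc hcγ hu)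

/-- … and the ceiling. [folklore] -/
theorem trunc_upper (hc : 0 < c) (hcγ : c ≤ γ) {βb : ℝ} (hbdd : ∀ u, SeqBox γ u → B u ≤ βb) :
    ∀ u, SeqBox γ u → (fun w : ℕ → ℝ => B (fun i => if i < K then w i else c)) u ≤ βb :=
  fun _ hu => hbdd _ (trunc_box hc hcγ hu)

/-- **THE TRUNCATION HAS THE FINITE WINDOW PROFILE.**  If `B` is level-Lipschitz in its first `K` coordinates with profile `Λ` whenever the remaining coordinates AGREE
(window grading `1∕γ² + (k+1)b₀ ≤ 1∕u_k²` for `k < K` only), then `B_K` has the profile `Λ` on `range K` in (E138)'s shape (any grading hypotheses for `k ≥ K` are simply not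
used). [folklore] -/
theorem trunc_profile (hc : 0 < c) (hcγ : c ≤ γ) {Λ : ℕ → ℝ} {b₀ : ℝ}
    (hwin : ∀ u v : ℕ → ℝ, SeqBox γ u → SeqBox γ v → (∀ k, k < K → 1 / γ ^ 2 + ((k : ℝ) + 1) * b₀ ≤ 1 / u k ^ 2) →
      (∀ k, k < K → 1 / γ ^ 2 + ((k : ℝ) + 1) * b₀ ≤ 1 / v k ^ 2) → (∀ k, K ≤ k → u k = v k) →
      B u - B v ≤ ∑ k ∈ range K, Λ k * max (1 / v k ^ 2 - 1 / u k ^ 2) 0) :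
    ∀ u v : ℕ → ℝ, SeqBox γ u → SeqBox γ v → (∀ k : ℕ, 1 / γ ^ 2 + ((k : ℝ) + 1) * b₀ ≤ 1 / u k ^ 2) →
      (∀ k : ℕ, 1 / γ ^ 2 + ((k : ℝ) + 1) * b₀ ≤ 1 / v k ^ 2) →
      (fun w : ℕ → ℝ => B (fun i => if i < K then w i else c)) u - (fun w : ℕ → ℝ => B (fun i => if i < K then w i else c)) v
        ≤ ∑ k ∈ range K, Λ k * max (1 / v k ^ 2 - 1 / u k ^ 2) 0 := by
  intro u v hu hv hgu hgv
  have h := hwin _ _ (trunc_box hc hcγ hu) (trunc_box hc hcγ hv)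
    (fun k hk => by show 1 / γ ^ 2 + ((k : ℝ) + 1) * b₀ ≤ 1 / (if k < K then u k else c) ^ 2; rw [if_pos hk]; exact hgu k)
    (fun k hk => by show 1 / γ ^ 2 + ((k : ℝ) + 1) * b₀ ≤ 1 / (if k < K then v k else c) ^ 2; rw [if_pos hk]; exact hgv k)
    (fun k hk => by show (if k < K then u k else c) = (if k < K then v k else c); rw [if_neg (by omega), if_neg (by omega)])
  refine h.trans (le_of_eq (sum_congr rfl fun k hk => ?_))
  have hkK := Finset.mem_range.mp hk
  show Λ k * max (1 / (if k < K then v k else c) ^ 2 - 1 / (if k < K then u k else c) ^ 2) 0 = Λ k * max (1 / v k ^ 2 - 1 / u k ^ 2) 0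
  rw [if_pos hkK, if_pos hkK]

/-- **THE TRUNCATION IS `η_K`-CLOSE**: if `|B u − B v| ≤ η` whenever `u, v ∈ ]0,γ]^ℕ` agree on the first `K` coordinates (fading tail), then `|B_K u − B u| ≤ η` on the box.
[folklore] -/
theorem trunc_close (hc : 0 < c) (hcγ : c ≤ γ) {η : ℝ}
    (htail : ∀ u v : ℕ → ℝ, SeqBox γ u → SeqBox γ v → (∀ k, k < K → u k = v k) → |B u - B v| ≤ η)
    (u : ℕ → ℝ) (hu : SeqBox γ u) :
    |(fun w : ℕ → ℝ => B (fun i => if i < K then w i else c)) u - B u| ≤ η :=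
  htail _ _ (trunc_box hc hcγ hu) hu fun k hk => by show (if k < K then u k else c) = u k; rw [if_pos hk]

/-! ## §2 A constant shift of a structured memory moves the levels by at most `j·d` -/

/-- **CONSTANT-SHIFT LEVEL GAP.**  `B₁`: isotone on `]0,γ]^ℕ`, zeroth moment `M`, floor `b > 0`, `B₁ ≤ β̄`, level-Lipschitz age profile `Λ` on `range K` over the graded box with
`θ = Σ_{k<K} k·Λ_k ≤ 1`; `d ≥ 0`; `h₁, h₂` box solutions of `B₁`, `B₁ + d` from one pin.  Then `h₂ ≤ h₁` ((E140a) with `τ = 0`: a constant excess is isotone) and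
**`1∕h₂_j² ≤ 1∕h₁_j² + j·d`** (the recursion: `L_{m+1} = L_m + B₁(tail h₂) − B₁(tail h₁) + d ≤ L_m + d` by isotonicity). [folklore] -/
theorem const_shift_levels {Λ : ℕ → ℝ} {K : ℕ} {βb p d : ℝ} {h₁ h₂ : ℕ → ℝ}
    (hmono : ∀ u v : ℕ → ℝ, SeqBox γ u → SeqBox γ v → (∀ i, u i ≤ v i) → B u ≤ B v)
    (hB : ∀ u u' : ℕ → ℝ, SeqBox γ u → SeqBox γ u' → ∀ D : ℝ, (∀ j, |u j - u' j| ≤ D) → |B u - B u'| ≤ M * D) (hM : 0 ≤ M)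
    (hb : 0 < b) (hlo : ∀ u, SeqBox γ u → b ≤ B u) (hbdd : ∀ u, SeqBox γ u → B u ≤ βb)
    (hΛ : ∀ k, 0 ≤ Λ k) (hθ1 : ∑ k ∈ range K, (k : ℝ) * Λ k ≤ 1)
    (hLip : ∀ u v : ℕ → ℝ, SeqBox γ u → SeqBox γ v → (∀ k : ℕ, 1 / γ ^ 2 + ((k : ℝ) + 1) * b ≤ 1 / u k ^ 2) →
      (∀ k : ℕ, 1 / γ ^ 2 + ((k : ℝ) + 1) * b ≤ 1 / v k ^ 2) → B u - B v ≤ ∑ k ∈ range K, Λ k * max (1 / v k ^ 2 - 1 / u k ^ 2) 0)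
    (hd : 0 ≤ d) (hp : 0 < p) (hpγ : p ≤ γ)
    (hh₁ : SeqBox γ h₁) (hf₁ : MemFlow B p h₁) (hh₂ : SeqBox γ h₂) (hf₂ : MemFlow (fun w => B w + d) p h₂) (j : ℕ) :
    h₂ j ≤ h₁ j ∧ 1 / h₂ j ^ 2 ≤ 1 / h₁ j ^ 2 + (j : ℝ) * d := by
  have hθτ : (1 + (0 : ℝ)) * ∑ k ∈ range K, (k : ℝ) * Λ k ≤ 1 := by linarith
  have hexc : ∀ u, SeqBox γ u → B u ≤ (fun w => B w + d) u := fun u _ => by show B u ≤ B u + d; linarith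
  have hbdd' : ∀ u, SeqBox γ u → (fun w => B w + d) u ≤ βb + d := fun u hu => by show B u + d ≤ βb + d; linarith [hbdd u hu]
  have hDdef : ∀ u v : ℕ → ℝ, SeqBox γ u → SeqBox γ v → (∀ i, u i ≤ v i) →
      (fun w => B w + d) u - B u ≤ (1 + (0 : ℝ)) * ((fun w => B w + d) v - B v) := fun u v _ _ _ => by
    show B u + d - B u ≤ (1 + 0) * (B v + d - B v); linarith
  have hcmp : ∀ i, h₂ i ≤ h₁ i := fun i =>
    le_of_excess_defect hmono hB hM hb hlo hΛ le_rfl hθτ hLip hexc hbdd' hDdef hp hpγ hh₁ hf₁ hh₂ hf₂ i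
  refine ⟨hcmp j, ?_⟩
  induction j with
  | zero => rw [hf₁.1, hf₂.1]; simp
  | succ m ih =>
    rw [hf₂.2 m, hf₁.2 m]
    have hiso : B (fun i => h₂ (m + 1 + i)) ≤ B (fun i => h₁ (m + 1 + i)) :=
      hmono _ _ (fun i => hh₂ _) (fun i => hh₁ _) fun i => hcmp _
    have : (fun w => B w + d) (fun i => h₂ (m + 1 + i)) = B (fun i => h₂ (m + 1 + i)) + d := rfl
    rw [this]
    push_cast
    linarith

end Summit.QuantumFields.BalabanUV.Beta.EriceRemainderEnclosureHistoryAutonomyComparisonDefectInfiniteMemoryLinks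

end
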